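import Summits.Ventures.HSemireg.SignedPureWeilSignLadder
import Summits.Ventures.HSemireg.SignedPureWeilMinimalDesigns
import Summits.Ventures.HSemireg.SignedPureWeilDesignsN6

/-!
# Venture HSemireg — THE GROWTH CONSTANT OF THE SUPPORT LADDER EXISTS: θ := lim s(n)^{1∕n} ∈ [2, 368^{1∕6}] and θⁿ ≤ 2·s(n) for every n

HONEST FRAMING. Part of the Lean index of the computation cell `pub-hsemireg` (Sunday typer seat p9, § g = 8; family B row **B20-3** of
`target-g8/CENSUS.md`: signed pure-Weil unit-graph designs are «class witnesses — cycles with ℤ-coefficients — not census objects»).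
FINITE INTEGER ∕ GAUSSIAN-INTEGER ARITHMETIC plus one elementary limit (Fekete's subadditive lemma, `Mathlib.Analysis.Subadditive`), in the
vocabulary of `SignedPureWeilLadder.lean` ∕ `SignedPureWeilTransport.lean` (`Letter`, `Eps`, `vmoment`, `plus`, `minus`, `supp`,
`tensor_trick`, `card_support_step`, `two_pow_le_card_support_pure`, `signLadder`, `rung1`, `rung2`, `design14`, `design28`, `design184`).
No abelian variety, cycle, sheaf or semiregularity map is constructed; nothing here says that HC ∕ HC_CM ∕ HC_AV holds; no object is
certified; no Literature fact is declared; no verdict ∕ door word ∕ count of the cell moves.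

THE STATEMENTS. For n ≥ 0 let **`sMin n`** = s(n) be the least support size of a pure W-alive integer design on (ℤ∕4)ⁿ (all
3ⁿ − 2 visible pattern moments vanish and `W = m̂(+,…,+) ≠ 0`; the set `suppSizes n` of such sizes is non-empty for every n —
the constant design at n = 0, `signLadder n` for n ≥ 1 — so `sMin n = sInf (suppSizes n)` is attained, `sMin_spec`). The files of this
lineage state their support bounds design by design («K ≤ #supp m for every pure W-alive m», «∃ m with #supp m = K»); §1–§2 repackage
them as statements about the FUNCTION s : ℕ → ℕ: `le_sMin_of_forall` ∕ `sMin_le_of_witness`, `one_le_sMin`, `two_pow_le_sMin`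
(2ⁿ ≤ s(n), LEMMA S), `two_mul_sMin_le_succ` (2·s(n) ≤ s(n+1), `card_support_step`), **`sMin_add_le`** (s(a+b) ≤ 2·s(a)·s(b), the
TENSOR TRICK), `sMin_succ_le` (s(n+1) ≤ 4·s(n)), and the kernel values ∕ brackets of record `sMin_one` (s(1) = 2), `sMin_two` (s(2) = 4),
`sMin_three` (8 ≤ s(3) ≤ 14), `sMin_four` (16 ≤ s(4) ≤ 28), `sMin_five` (32 ≤ s(5) ≤ 80), `sMin_six` (64 ≤ s(6) ≤ 184).

§3 **THE GROWTH CONSTANT.** By the tensor trick the sequence `uSeq n = log (2·s(n))` is SUBADDITIVE (`uSeq_subadditive`: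
2·s(a+b) ≤ (2·s(a))·(2·s(b))) and `uSeq n ∕ n ≥ 0`, so by Fekete's lemma `uSeq n ∕ n` converges to its infimum `logTheta` over n ≥ 1
(`tendsto_uSeq_div`); since `log 2 ∕ n → 0`, **`log s(n) ∕ n → logTheta`** (`tendsto_log_sMin_div`) and, with **`theta = exp logTheta`**,
**`s(n)^{1∕n} → theta`** (`tendsto_sMin_rpow_inv`): THE GROWTH CONSTANT θ = lim_n s(n)^{1∕n} OF THE SUPPORT LADDER EXISTS. Bounds:
**`theta_pow_le`** (θⁿ ≤ 2·s(n) for every n ≥ 1 — θ is the infimum of (2 s(n))^{1∕n}), **`two_le_theta`** (2 ≤ θ, from 2ⁿ ≤ s(n)),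
`theta_pow_four_le` (θ⁴ ≤ 56, design28), **`theta_pow_six_le`** (θ⁶ ≤ 368, design184), `theta_lt` (θ < 2.68), so **θ ∈ [2, 2.68)**.
This is the kernel form of §3.3 of `HOME/p9/STRUCTURE-LATTICE-p9g11.md` (there via complex single-moment designs; here directly: 2·s is
submultiplicative). OPEN (numbers of record, machine, not kernel): s(3) = 14, s(4) = 28, s(5) ∈ [72, 80]; whether θ = 2.

WHAT IS NOT HERE. Any new lower bound on a single s(n); the complex single-moment sparsity c(n); LEMMA W; sheaves or semiregularity.
-/

namespace Summit.Ventures.HSemireg.SignedWeilDesignN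

open Finset Filter Topology

variable {n a b : ℕ}

/-! ## §1 The support ladder as a function s : ℕ → ℕ -/

/-- The set of support sizes of PURE (every visible pattern moment vanishes) and W-ALIVE (`W = m̂(+,…,+) ≠ 0`) signed designs
on (ℤ∕4)ⁿ. [definition of this file] -/
def suppSizes (n : ℕ) : Set ℕ :=
  {K | ∃ m : Letter n → ℤ, (∀ ε : Eps n, ε ≠ plus → ε ≠ minus → vmoment m ε = 0) ∧ vmoment m plus ≠ 0 ∧ (supp m).card = K}

/-- **s(n)**: the least number of letters of a pure W-alive signed design on (ℤ∕4)ⁿ. [definition of this file] -/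
noncomputable def sMin (n : ℕ) : ℕ := sInf (suppSizes n)

/-- The constant design 1 on the one-point space (ℤ∕4)⁰ is W-alive (and pure, vacuously: every pattern is `plus`). -/
theorem const_zero_alive : vmoment (fun _ : Letter 0 => (1 : ℤ)) plus ≠ 0 := by
  decide

/-- The set of support sizes is non-empty for every n (the constant design at n = 0, `signLadder n` of row L for n ≥ 1). -/
theorem suppSizes_nonempty (n : ℕ) : (suppSizes n).Nonempty := by
  rcases Nat.eq_zero_or_pos n with rfl | hn
  · exact ⟨_, _, fun ε hp _ => absurd (funext fun k => Fin.elim0 k) hp, const_zero_alive, rfl⟩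
  · exact ⟨_, _, (signLadder_spec n hn).1, signLadder_alive hn, rfl⟩

/-- s(n) is attained: some pure W-alive design on (ℤ∕4)ⁿ has exactly `sMin n` letters. -/
theorem sMin_spec (n : ℕ) : ∃ m : Letter n → ℤ,
    (∀ ε : Eps n, ε ≠ plus → ε ≠ minus → vmoment m ε = 0) ∧ vmoment m plus ≠ 0 ∧ (supp m).card = sMin n :=
  Nat.sInf_mem (suppSizes_nonempty n)

/-- s(n) is a lower bound: every pure W-alive design on (ℤ∕4)ⁿ has at least `sMin n` letters. -/
theorem sMin_le_card (m : Letter n → ℤ) (hpure : ∀ ε : Eps n, ε ≠ plus → ε ≠ minus → vmoment m ε = 0)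
    (halive : vmoment m plus ≠ 0) : sMin n ≤ (supp m).card :=
  Nat.sInf_le ⟨m, hpure, halive, rfl⟩

/-- Witness form of the upper bound: a pure W-alive design with K letters gives s(n) ≤ K. -/
theorem sMin_le_of_witness (m : Letter n → ℤ) (hpure : ∀ ε : Eps n, ε ≠ plus → ε ≠ minus → vmoment m ε = 0)
    (halive : vmoment m plus ≠ 0) {K : ℕ} (hK : (supp m).card = K) : sMin n ≤ K :=
  hK ▸ sMin_le_card m hpure halive

/-- Lower-bound form: a bound valid for every pure W-alive design is a bound for s(n). -/
theorem le_sMin_of_forall {b : ℕ}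
    (hb : ∀ m : Letter n → ℤ, (∀ ε : Eps n, ε ≠ plus → ε ≠ minus → vmoment m ε = 0) → vmoment m plus ≠ 0 → b ≤ (supp m).card) :
    b ≤ sMin n := by
  obtain ⟨m, hp, ha, hc⟩ := sMin_spec n
  exact hc ▸ hb m hp ha

/-- A W-alive design has a letter: 1 ≤ s(n) for every n. -/
theorem one_le_sMin (n : ℕ) : 1 ≤ sMin n := by
  obtain ⟨m, _, ha, hc⟩ := sMin_spec n
  rw [← hc, Nat.one_le_iff_ne_zero]
  intro h0
  apply ha
  have hz : ∀ x, m x = 0 := fun x => by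
    by_contra hx
    have : x ∈ supp m := by simp [supp, hx]
    rw [Finset.card_eq_zero.mp h0] at this
    simp at this
  simp [vmoment, hz]

/-- LEMMA S iterated (`two_pow_le_card_support_pure`): 2ⁿ ≤ s(n) for n ≥ 1. -/
theorem two_pow_le_sMin (hn : 0 < n) : 2 ^ n ≤ sMin n :=
  le_sMin_of_forall (two_pow_le_card_support_pure n hn)

/-- The slice step (`card_support_step`): 2·s(n) ≤ s(n+1) for n ≥ 1. -/
theorem two_mul_sMin_le_succ (hn : 0 < n) : 2 * sMin n ≤ sMin (n + 1) :=
  le_sMin_of_forall (card_support_step hn (sMin n) (fun m hp ha => sMin_le_card m hp ha))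

/-- **THE TENSOR TRICK for the function s: s(a + b) ≤ 2·s(a)·s(b)** (a, b ≥ 1). -/
theorem sMin_add_le (ha : 0 < a) (hb : 0 < b) : sMin (a + b) ≤ 2 * (sMin a * sMin b) := by
  obtain ⟨m₁, hp₁, ha₁, hc₁⟩ := sMin_spec a
  obtain ⟨m₂, hp₂, ha₂, hc₂⟩ := sMin_spec b
  obtain ⟨m, hp, hal, hc⟩ := tensor_trick ha hb m₁ m₂ hp₁ ha₁ hp₂ ha₂
  rw [hc₁, hc₂] at hc
  exact (sMin_le_card m hp hal).trans hc

/-! ## §2 Kernel values and brackets of record, as statements about s -/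

/-- s(1) = 2 (rung1; LEMMA S). -/
theorem sMin_one : sMin 1 = 2 :=
  le_antisymm (sMin_le_of_witness rung1 rungs_certificate.1.1 rungs_certificate.1.2.1 rungs_certificate.1.2.2)
    (two_pow_le_sMin (n := 1) Nat.one_pos)

/-- s(2) = 4 (rung2; LEMMA S). -/
theorem sMin_two : sMin 2 = 4 :=
  le_antisymm (sMin_le_of_witness rung2 rungs_certificate.2.1.1 rungs_certificate.2.1.2.1 rungs_certificate.2.1.2.2)
    (two_pow_le_sMin (n := 2) (by norm_num))

/-- 8 ≤ s(3) ≤ 14 in the kernel (design14; of record, machine: s(3) = 14). -/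
theorem sMin_three : 8 ≤ sMin 3 ∧ sMin 3 ≤ 14 :=
  ⟨two_pow_le_sMin (n := 3) (by norm_num),
    sMin_le_of_witness design14 design14_certificate.1 (by rw [design14_certificate.2.1]; decide) design14_certificate.2.2⟩

/-- 16 ≤ s(4) ≤ 28 in the kernel (design28; of record, machine: s(4) = 28). -/
theorem sMin_four : 16 ≤ sMin 4 ∧ sMin 4 ≤ 28 :=
  ⟨two_pow_le_sMin (n := 4) (by norm_num),
    sMin_le_of_witness design28 design28_certificate.1 (by rw [design28_certificate.2.1]; decide) design28_certificate.2.2⟩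

/-- 32 ≤ s(5) ≤ 80 in the kernel (design80; of record, machine: 72 ≤ s(5) ≤ 80). -/
theorem sMin_five : 32 ≤ sMin 5 ∧ sMin 5 ≤ 80 :=
  ⟨two_pow_le_sMin (n := 5) (by norm_num),
    sMin_le_of_witness design80 design80_certificate.1 (by rw [design80_certificate.2.1]; decide) design80_certificate.2.2⟩

/-- 64 ≤ s(6) ≤ 184 in the kernel (design184). -/
theorem sMin_six : 64 ≤ sMin 6 ∧ sMin 6 ≤ 184 :=
  ⟨two_pow_le_sMin (n := 6) (by norm_num),
    sMin_le_of_witness design184 design184_certificate.1 (by rw [design184_certificate.2.1]; decide) design184_certificate.2.2⟩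

/-- s(n+1) ≤ 4·s(n) for n ≥ 1 (tensor trick with the 2-letter rung): consecutive ratios s(n+1)∕s(n) lie in [2, 4]. -/
theorem sMin_succ_le (hn : 0 < n) : sMin (n + 1) ≤ 4 * sMin n := by
  have h := sMin_add_le hn (show 0 < 1 by norm_num)
  rw [sMin_one] at h
  omega

/-- s(n) ≤ 2^{⌊(3n−1)∕2⌋} for every n ≥ 1 (the sign ladder, row L). -/
theorem sMin_le_pow (hn : 0 < n) : sMin n ≤ 2 ^ ((3 * n - 1) / 2) :=
  sMin_le_of_witness (signLadder n) (signLadder_spec n hn).1 (signLadder_alive hn) (card_supp_signLadder hn)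

/-! ## §3 The growth constant θ = lim s(n)^{1∕n} -/

/-- `u(n) = log (2·s(n))`. [definition of this file] -/
noncomputable def uSeq (n : ℕ) : ℝ := Real.log (2 * (sMin n : ℝ))

/-- `2·s(n) ≥ 2 > 0`. -/
theorem two_mul_sMin_pos (n : ℕ) : (0 : ℝ) < 2 * (sMin n : ℝ) := by
  have h := one_le_sMin n
  have : (1 : ℝ) ≤ (sMin n : ℝ) := by exact_mod_cast h
  linarith

/-- `u(n) ≥ 0`. -/
theorem uSeq_nonneg (n : ℕ) : 0 ≤ uSeq n := by
  unfold uSeq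
  apply Real.log_nonneg
  have : (1 : ℝ) ≤ (sMin n : ℝ) := by exact_mod_cast one_le_sMin n
  linarith

/-- **`u` is subadditive**: 2·s(a+b) ≤ (2·s(a))·(2·s(b)) by the tensor trick (a, b ≥ 1; trivially if a = 0 or b = 0 since u ≥ 0). -/
theorem uSeq_subadditive : Subadditive uSeq := by
  intro a b
  rcases Nat.eq_zero_or_pos a with rfl | ha
  · rw [zero_add]; linarith [uSeq_nonneg 0]
  rcases Nat.eq_zero_or_pos b with rfl | hb
  · rw [add_zero]; linarith [uSeq_nonneg 0]
  have h := sMin_add_le ha hb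
  have hR : (2 : ℝ) * (sMin (a + b) : ℝ) ≤ (2 * (sMin a : ℝ)) * (2 * (sMin b : ℝ)) := by
    have : ((sMin (a + b) : ℕ) : ℝ) ≤ ((2 * (sMin a * sMin b) : ℕ) : ℝ) := by exact_mod_cast h
    push_cast at this
    linarith
  unfold uSeq
  rw [← Real.log_mul (two_mul_sMin_pos a).ne' (two_mul_sMin_pos b).ne']
  exact Real.log_le_log (two_mul_sMin_pos _) hR

/-- `u(n)∕n` is bounded below (by 0). -/
theorem uSeq_div_bddBelow : BddBelow (Set.range fun n : ℕ => uSeq n / n) :=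
  ⟨0, by rintro _ ⟨n, rfl⟩; exact div_nonneg (uSeq_nonneg n) (Nat.cast_nonneg n)⟩

/-- `log θ` := the Fekete limit `inf_{n ≥ 1} u(n)∕n`. [definition of this file] -/
noncomputable def logTheta : ℝ := uSeq_subadditive.lim

/-- **θ, the growth constant of the support ladder.** [definition of this file] -/
noncomputable def theta : ℝ := Real.exp logTheta

/-- Fekete: `u(n)∕n → log θ`. -/
theorem tendsto_uSeq_div : Tendsto (fun n : ℕ => uSeq n / n) atTop (𝓝 logTheta) :=
  uSeq_subadditive.tendsto_lim uSeq_div_bddBelow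

/-- `log θ ≤ u(n)∕n` for every n ≥ 1 (θ is an infimum). -/
theorem logTheta_le_div (hn : n ≠ 0) : logTheta ≤ uSeq n / n :=
  uSeq_subadditive.lim_le_div uSeq_div_bddBelow hn

/-- `u(n) = log 2 + log s(n)`. -/
theorem uSeq_eq (n : ℕ) : uSeq n = Real.log 2 + Real.log (sMin n) := by
  unfold uSeq
  have : (sMin n : ℝ) ≠ 0 := by
    have := one_le_sMin n
    exact_mod_cast (by omega : sMin n ≠ 0)
  rw [Real.log_mul two_ne_zero this]

/-- **`log s(n) ∕ n → log θ`.** -/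
theorem tendsto_log_sMin_div : Tendsto (fun n : ℕ => Real.log (sMin n) / n) atTop (𝓝 logTheta) := by
  have h2 : Tendsto (fun n : ℕ => Real.log 2 / (n : ℝ)) atTop (𝓝 0) := tendsto_const_div_atTop_nhds_zero_nat _
  have := tendsto_uSeq_div.sub h2
  rw [sub_zero] at this
  refine this.congr (fun n => ?_)
  rw [uSeq_eq, add_div]
  ring

/-- **THE GROWTH CONSTANT EXISTS: s(n)^{1∕n} → θ.** -/
theorem tendsto_sMin_rpow_inv : Tendsto (fun n : ℕ => ((sMin n : ℝ)) ^ ((n : ℝ)⁻¹)) atTop (𝓝 theta) := by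
  have hpos : ∀ n, (0 : ℝ) < (sMin n : ℝ) := fun n => by exact_mod_cast one_le_sMin n
  have : (fun n : ℕ => ((sMin n : ℝ)) ^ ((n : ℝ)⁻¹)) = fun n : ℕ => Real.exp (Real.log (sMin n) / n) := by
    funext n
    rw [Real.rpow_def_of_pos (hpos n), div_eq_mul_inv]
  rw [this]
  exact (Real.continuous_exp.tendsto _).comp tendsto_log_sMin_div

/-- θ > 0. -/
theorem theta_pos : 0 < theta := Real.exp_pos _

/-- **θⁿ ≤ 2·s(n) for every n ≥ 1** (θ = inf_n (2 s(n))^{1∕n}). -/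
theorem theta_pow_le (hn : 0 < n) : theta ^ n ≤ 2 * (sMin n : ℝ) := by
  have h := logTheta_le_div hn.ne'
  have hn' : (0 : ℝ) < n := by exact_mod_cast hn
  have hmul : (n : ℝ) * logTheta ≤ uSeq n := by
    have := mul_le_mul_of_nonneg_left h hn'.le
    rwa [mul_div_cancel₀ _ hn'.ne'] at this
  unfold theta
  rw [← Real.exp_nat_mul, ← Real.exp_log (two_mul_sMin_pos n)]
  exact Real.exp_le_exp.mpr hmul

/-- **2 ≤ θ** (from 2ⁿ ≤ s(n): u(n)∕n ≥ log 2 for every n ≥ 1). -/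
theorem two_le_theta : 2 ≤ theta := by
  have hlog : Real.log 2 ≤ logTheta := by
    refine ge_of_tendsto tendsto_uSeq_div ?_
    rw [eventually_atTop]
    refine ⟨1, fun n hn => ?_⟩
    have hn' : (0 : ℝ) < n := by exact_mod_cast hn
    rw [le_div_iff₀ hn']
    have hs : (2 : ℝ) ^ n ≤ (sMin n : ℝ) := by exact_mod_cast two_pow_le_sMin hn
    have h1 : Real.log 2 * n = Real.log ((2 : ℝ) ^ n) := by rw [Real.log_pow]; ring
    rw [h1]
    unfold uSeq
    apply Real.log_le_log (by positivity)
    linarith [two_mul_sMin_pos n, hs, show (0:ℝ) < 2 ^ n by positivity]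
  unfold theta
  rw [← Real.exp_log two_pos]
  exact Real.exp_le_exp.mpr hlog

/-- θ⁴ ≤ 56 (design28). -/
theorem theta_pow_four_le : theta ^ 4 ≤ 56 := by
  have h := theta_pow_le (show 0 < 4 by norm_num)
  have : (sMin 4 : ℝ) ≤ 28 := by exact_mod_cast sMin_four.2
  linarith

/-- **θ⁶ ≤ 368** (design184): θ ≤ 368^{1∕6} < 2.68. -/
theorem theta_pow_six_le : theta ^ 6 ≤ 368 := by
  have h := theta_pow_le (show 0 < 6 by norm_num)
  have : (sMin 6 : ℝ) ≤ 184 := by exact_mod_cast sMin_six.2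
  linarith

/-- **θ ∈ [2, 2.68)**. -/
theorem theta_lt : theta < 2.68 := by
  by_contra h
  rw [not_lt] at h
  have h6 : (2.68 : ℝ) ^ 6 ≤ theta ^ 6 := by gcongr
  have := theta_pow_six_le
  norm_num at h6
  linarith

/-- Summary: the growth constant exists, `s(n)^{1∕n} → θ`, with `2 ≤ θ < 2.68` and `θⁿ ≤ 2·s(n)` for every n ≥ 1. -/
theorem growth_constant :
    Tendsto (fun n : ℕ => ((sMin n : ℝ)) ^ ((n : ℝ)⁻¹)) atTop (𝓝 theta) ∧ 2 ≤ theta ∧ theta < 2.68 ∧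
      ∀ n : ℕ, 0 < n → theta ^ n ≤ 2 * (sMin n : ℝ) :=
  ⟨tendsto_sMin_rpow_inv, two_le_theta, theta_lt, fun _ hn => theta_pow_le hn⟩

end Summit.Ventures.HSemireg.SignedWeilDesignN
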